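import Summits.Ventures.Crystal3D.Theorems.StickyWulffConstantCoaxialWallLawSeamFullEndUnsaturated
import HarnessLib

/-!
# E1 in the lane's predicates: a SATURATED ball over a closed slot star is FULL or TWIN-READING (star on the own side)
# (crux `CoaxialWallLaw`, stmt-Ventures-19481; lane F 'Certificates' v8.3R, registered stub `stub_threePayer`; tool for the FULL/CROSS row tables of `SatCensus11Full/Cross`)

HONEST FRAMING. Venture `Summits/Ventures/Crystal3D` (cell `crystal3d-full`); sequel of '…SeamFullEndUnsaturated'.  CONDITIONAL on `P5Exhaustion` (`stub_E1`).
`shell_slots_or_twin_of_star_twelve` ('…SaturatedStar') describes the twelve contacts of a saturated ball `y` carrying the closed star of a slot `δ` in a frame `A` as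
«all slot balls» or «own slots + mirrors of a menu normal».  THIS FILE repackages that conclusion in the predicates of the end-row automaton ('…EndRowDefs'):
**`isFull_or_isTwinReading_of_star_twelve`** — `y` is `A`-FULL (`IsFull X A y`), or there is a menu normal `n` of `A` with `IsTwinReading X A n y` (own nine occupied,
three mirrors occupied, three far slots EMPTY) and the star on the own side (`⟪A w, n⟫ ≤ 0` whenever `⟪w, δ⟫ > 0`).  This is the per-co-neighbour datum of the
FULL/CROSS-reader row tables of seat 19481-p2 g14 (memo F-TAIL-g14 §5: 85 + 21 rows): each saturated common neighbour of the end ball and its reader is FULL or one of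
the two twins keeping its star own-side, which forces / forbids specific balls around the end ball.
* `isFull_of_contacts_slots`, `isTwinReading_of_contacts_twin` (twelve contacts at slot / twin-dozen positions exhaust the dozen), **`isFull_or_isTwinReading_of_star_twelve`**,
  `slot_occupied_iff_of_twinReading` (bookkeeping: under a twin reading a slot ball `y + A w` is present iff `⟪A w, n⟫ ≤ 0`).
WHAT THIS IS NOT: no row is treated here; F-C1 not moved.
-/

noncomputable section

namespace Summit.Ventures.Crystal3D.Theorems

namespace TailResidue

open Summit.Ventures.Crystal3D Finset
open scoped InnerProductSpace

variable {X : Finset (EuclideanSpace ℝ (Fin 3))}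

open scoped Classical in
/-- **Twelve contacts, all slot balls ⇒ FULL.** -/
theorem isFull_of_contacts_slots (A : EuclideanSpace ℝ (Fin 3) ≃ₗᵢ[ℝ] EuclideanSpace ℝ (Fin 3)) {y : EuclideanSpace ℝ (Fin 3)}
    (h12 : (X.filter fun c => dist y c = 1).card = 12) (hall : ∀ c ∈ X, dist y c = 1 → ∃ w ∈ fccSlots, c = y + A w) : IsFull X A y := by
  set C := X.filter fun c => dist y c = 1 with hC
  set I := fccSlots.image fun w => y + A w with hI
  have hCI : C ⊆ I := by
    intro c hc
    obtain ⟨hcX, hcd⟩ := mem_filter.1 hc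
    obtain ⟨w, hw, rfl⟩ := hall c hcX hcd
    exact mem_image.2 ⟨w, hw, rfl⟩
  have hIC : I ⊆ C := (eq_of_subset_of_card_le hCI (by rw [card_image_frame A y, h12])).symm.subset
  intro w hw
  exact (mem_filter.1 (hIC (mem_image.2 ⟨w, hw, rfl⟩))).1

open scoped Classical in
/-- **Twelve contacts, all twin-dozen members ⇒ TWIN-READING.**  (Own side occupied is part of the conclusion via the count; far slots are empty because a far slot ball
would be a contact that is neither an own slot nor a mirror — `slot_ne_mirror`.) -/
theorem isTwinReading_of_contacts_twin (A : EuclideanSpace ℝ (Fin 3) ≃ₗᵢ[ℝ] EuclideanSpace ℝ (Fin 3))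
    {y n : EuclideanSpace ℝ (Fin 3)} (hn : IsMenuNormal A n) (h12 : (X.filter fun c => dist y c = 1).card = 12)
    (hall : ∀ c ∈ X, dist y c = 1 → (∃ w ∈ fccSlots, ⟪A w, n⟫_ℝ ≤ 0 ∧ c = y + A w) ∨ ∃ w ∈ fccSlots, ⟪A w, n⟫_ℝ < 0 ∧ c = y + (A w - (2 * ⟪A w, n⟫_ℝ) • n)) :
    IsTwinReading X A n y := by
  set C := X.filter fun c => dist y c = 1 with hC
  set D := ((fccSlots.filter fun w => ⟪A w, n⟫_ℝ ≤ 0).image fun w => y + A w) ∪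
      ((fccSlots.filter fun w => ⟪A w, n⟫_ℝ < 0).image fun w => y + (A w - (2 * ⟪A w, n⟫_ℝ) • n)) with hD
  have hCD : C ⊆ D := by
    intro c hc
    obtain ⟨hcX, hcd⟩ := mem_filter.1 hc
    exact (mem_twinDozen_iff A n y c).2 (hall c hcX hcd)
  have hDC : D ⊆ C := (eq_of_subset_of_card_le hCD (by rw [card_twinDozen A hn.1 y, h12])).symm.subset
  have hslot_contact : ∀ {w}, w ∈ fccSlots → y + A w ∈ X → y + A w ∈ C := fun {w} hw hmem =>
    mem_filter.2 ⟨hmem, by rw [dist_eq_norm, sub_add_cancel_left, norm_neg, LinearIsometryEquiv.norm_map, norm_eq_one_of_mem_fccSlots hw]⟩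
  refine ⟨hn, fun w hw hle => ?_, fun w hw hlt => ?_, fun w hw hpos hmem => ?_⟩
  · exact (mem_filter.1 (hDC ((mem_twinDozen_iff A n y _).2 (Or.inl ⟨w, hw, hle, rfl⟩)))).1
  · exact (mem_filter.1 (hDC ((mem_twinDozen_iff A n y _).2 (Or.inr ⟨w, hw, hlt, rfl⟩)))).1
  · rcases hall _ hmem (mem_filter.1 (hslot_contact hw hmem)).2 with ⟨w', hw', hle', he⟩ | ⟨w', hw', hlt', he⟩
    · have : w = w' := A.injective (add_left_cancel he)
      rw [this] at hpos; linarith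
    · exact slot_ne_mirror A hn hw hw' hlt' (add_left_cancel he)

open scoped Classical in
/-- **E1 IN THE LANE'S PREDICATES.**  Under `P5Exhaustion`: `X` `1`-separated, the closed star of the slot `δ` in the frame `A` occupied around `y`, `y` saturated.  Then
`y` is `A`-FULL, or `y` is TWIN-READING for a menu normal `n` of `A` with the star on the own side. -/
theorem isFull_or_isTwinReading_of_star_twelve (hE1 : P5Exhaustion) (hX : ∀ p ∈ X, ∀ p' ∈ X, p ≠ p' → 1 ≤ dist p p')
    (A : EuclideanSpace ℝ (Fin 3) ≃ₗᵢ[ℝ] EuclideanSpace ℝ (Fin 3)) {y δ : EuclideanSpace ℝ (Fin 3)} (hδ : δ ∈ fccSlots)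
    (hstar : ∀ w ∈ fccSlots, 0 < ⟪w, δ⟫_ℝ → y + A w ∈ X) (h12 : (X.filter fun c => dist y c = 1).card = 12) :
    IsFull X A y ∨ ∃ n, IsTwinReading X A n y ∧ ∀ w ∈ fccSlots, 0 < ⟪w, δ⟫_ℝ → ⟪A w, n⟫_ℝ ≤ 0 := by
  rcases shell_slots_or_twin_of_star_twelve hE1 A hX hδ hstar h12 with hall | ⟨n, hn, -, hall⟩
  · exact Or.inl (isFull_of_contacts_slots A h12 hall)
  · refine Or.inr ⟨n, isTwinReading_of_contacts_twin A hn h12 hall, fun w hw hpos => ?_⟩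
    have hmem := hstar w hw hpos
    have hd : dist y (y + A w) = 1 := by rw [dist_eq_norm, sub_add_cancel_left, norm_neg, LinearIsometryEquiv.norm_map, norm_eq_one_of_mem_fccSlots hw]
    rcases hall _ hmem hd with ⟨w', hw', hle', he⟩ | ⟨w', hw', hlt', he⟩
    · have : w = w' := A.injective (add_left_cancel he)
      rw [this]; exact hle'
    · exact absurd (add_left_cancel he) (slot_ne_mirror A hn hw hw' hlt')

/-- **Bookkeeping under a twin reading**: a slot ball `y + A w` is present iff `⟪A w, n⟫ ≤ 0`. -/
theorem slot_occupied_iff_of_twinReading (A : EuclideanSpace ℝ (Fin 3) ≃ₗᵢ[ℝ] EuclideanSpace ℝ (Fin 3)) {y n : EuclideanSpace ℝ (Fin 3)} (htw : IsTwinReading X A n y)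
    {w : EuclideanSpace ℝ (Fin 3)} (hw : w ∈ fccSlots) : y + A w ∈ X ↔ ⟪A w, n⟫_ℝ ≤ 0 := by
  constructor
  · intro hmem
    by_contra hlt
    exact htw.2.2.2 w hw (lt_of_not_ge hlt) hmem
  · exact htw.2.1 w hw

end TailResidue

end Summit.Ventures.Crystal3D.Theorems

end
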